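import Summits.BirchSwinnertonDyer.Rank1Residual.F1Sign2.TwistSelmerRelaxedAtInfinityAtTwo
import Summits.BirchSwinnertonDyer.BirchSwinnertonDyer.Theorems.GenusKolyvaginAtTwoGenusPrimitiveSupplyAtTwoArchimedeanKummerCount
import Summits.BirchSwinnertonDyer.BirchSwinnertonDyer.Theorems.GenusKolyvaginAtTwoGenusPrimitiveSupplyAtTwoArchimedeanKummerCard
import Summits.BirchSwinnertonDyer.BirchSwinnertonDyer.Theorems.SchneiderFreeAdditiveX3PoitouTateReciprocitySumHolds
import Summits.BirchSwinnertonDyer.Rank1Residual.GaloisImage.PropagatedConditionCardEP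
import HarnessLib

/-!
# Route `GenusKolyvaginAtTwo`, crux #2 `GenusPrimitiveSupplyAtTwo` (stmt-BirchSwinnertonDyer-22136):
# THE ∞-RELAXED `2`-SELMER GROUP — DESC-§17-IDX `F1Sign2.SelmerIndexInRelaxedAtInfinityAtTwo` IS A THEOREM
# (`[Sel^{rel ∞}_2(W) : Sel₂(W)] ∈ {1, 2}` for every `E/ℚ`), and the dictionary `Sel^{rel ∞}_2(W) = H¹_{kummerRelaxed {∞}}`

Width seat `bsd-line-gk2-p4` g14 (cell `bsd-f1-sign2`); lane: the transposition / two-transposition doors (T-q₀, T-2q, AN-24S/L), whose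
T-2q `iff` clause is phrased with the cell's `selmerGroupRelaxedAtInfinityAtTwo W` (-desc g9 / -ty g3, `F1Sign2/TwistSelmerRelaxedAtInfinityAtTwo.lean`).
THEOREMS ONLY (no definition, no named fact, no `sorry`); helper `--supports stmt-BirchSwinnertonDyer-22136`; no item is closed; BSD is
not proved by any of this.

WHAT.
* `selmerGroupRelaxedAtInfinityAtTwo_eq_kummerRelaxed` — the DICTIONARY: the cell's `Sel^{rel ∞}_2(W)` (finite local kernels of `Selmer.lean` only) IS
  the Selmer group of X11b's `kummerRelaxed W 2 {∞}` (the Kummer structure of `E[2]` made `⊤` at the real place) inside `H¹(ℚ, E[2])` — so every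
  relaxed/strict count of the GenusKoly files applies to it.
* **`selmerIndexInRelaxedAtInfinityAtTwo_holds : SelmerIndexInRelaxedAtInfinityAtTwo`** (DESC-§17-IDX BY NAME; Mazur–Rubin 2010 Lemma 3.2 at `T = {∞}`,
  the real place being the cell's own case): `Sel₂(W) ≤ Sel^{rel ∞}_2(W)` with index `1` or `2`. Proof: `H¹_{strict ∞} ≤ Sel₂(W) ≤ H¹_{relaxed ∞}` and
  `[H¹_{relaxed ∞} : H¹_{strict ∞}] = #𝓛_∞` (gk2-p5's archimedean Kummer count `relIndex_kummerStrict_kummerRelaxed_singleton_inl_eq_of_facts`, its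
  Poitou–Tate and Euler–Poincaré inputs DISCHARGED by `poitouTate_selmerStructure_duality_real_holds` and
  `forall_localEulerPoincareCharacteristic_adicCompletion`), with `#𝓛_∞ = 2` (`Δ > 0`) or `1` (`Δ < 0`); the index of the middle term divides it.

References: [MazurRubin2010] Def. 3.1, Lemma 3.2; [MilneADT2006] I Thm. 4.10, Lemma 6.15; [Kramer1981] Prop. 6.
-/

set_option linter.dupNamespace false -- tree convention: `Summit.BirchSwinnertonDyer.BirchSwinnertonDyer.Theorems` (summit = sub-problem)
set_option autoImplicit false

noncomputable section

open scoped Classical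

namespace Summit.BirchSwinnertonDyer.BirchSwinnertonDyer.Theorems.GenusKolyTransp

open WeierstrassCurve NumberField IsDedekindDomain
open Literature.NumberTheory.EllipticCurves Literature.NumberTheory.GaloisRepresentations
open Literature.NumberTheory.GaloisRepresentations.DiscreteGaloisModule (SelmerStructure)
open Literature.NumberTheory.GaloisCohomology
open Summit.BirchSwinnertonDyer.Rank1Residual.F1Sign2 (selmerGroupRelaxedAtInfinityAtTwo SelmerIndexInRelaxedAtInfinityAtTwo
  selmerGroup_le_selmerGroupRelaxedAtInfinityAtTwo mem_selmerGroupRelaxedAtInfinityAtTwo_iff)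
open Summit.BirchSwinnertonDyer.Rank1Residual.X11b.KummerPT (kummerRelaxed kummerStrict kummerRelaxed_of_mem kummerRelaxed_of_not_mem
  kummerStrict_of_mem kummerStrict_of_not_mem)
open Summit.BirchSwinnertonDyer.BirchSwinnertonDyer.Theorems.GenusKolyArch
open Summit.BirchSwinnertonDyer.BirchSwinnertonDyer.Theorems.SchneiderFreeAdditiveX3.PoitouTateReduction
  (poitouTate_selmerStructure_duality_real_holds)
open Summit.BirchSwinnertonDyer.Rank1Residual.GaloisImage.EP (forall_localEulerPoincareCharacteristic_adicCompletion)

/-! ## §21 The dictionary `Sel^{rel ∞}_2(W) = H¹_{kummerRelaxed {∞}}(ℚ, E[2])` -/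

/-- **The cell's ∞-relaxed `2`-Selmer group is X11b's `kummerRelaxed` Selmer group at `S' = {∞}`**: both are «the Kummer condition at every
finite place, no condition at the real place» inside `H¹(ℚ, E[2])` (`comap_localization_kummerSelmerStructure`; `ℚ` has one infinite place).
[cite: MazurRubin2010, Def. 3.1] -/
theorem selmerGroupRelaxedAtInfinityAtTwo_eq_kummerRelaxed (W : WeierstrassCurve ℚ) [W.IsElliptic] :
    selmerGroupRelaxedAtInfinityAtTwo W =
      (kummerRelaxed W 2 {(Sum.inl Rat.infinitePlace : Place ℚ)}).selmerGroup := by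
  ext c
  refine (mem_selmerGroupRelaxedAtInfinityAtTwo_iff W c).trans
    (Iff.trans ?_ ((kummerRelaxed W 2 {(Sum.inl Rat.infinitePlace : Place ℚ)}).mem_selmerGroup_iff c).symm)
  have hfin : ∀ v : HeightOneSpectrum (𝓞 ℚ),
      (Sum.inr v : Place ℚ) ∉ ({Sum.inl Rat.infinitePlace} : Finset (Place ℚ)) := fun v ↦ by simp
  have hdict : ∀ v : HeightOneSpectrum (𝓞 ℚ),
      c ∈ W.selmerLocalKer (v.adicCompletion ℚ) ((2 : ℕ) : ℤ) ↔
        galoisCohomology.localization (W.torsionGaloisModule ((2 : ℕ) : ℤ)) (Sum.inr v) 1 c ∈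
          W.kummerSelmerStructure ((2 : ℕ) : ℤ) (Sum.inr v) := fun v ↦ by
    rw [← AddSubgroup.mem_comap, W.comap_localization_kummerSelmerStructure ((2 : ℕ) : ℤ) (Sum.inr v)]
    rfl
  constructor
  · intro h v
    rcases v with w | v
    · have hw : (Sum.inl w : Place ℚ) ∈ ({Sum.inl Rat.infinitePlace} : Finset (Place ℚ)) := by
        rw [Finset.mem_singleton, Subsingleton.elim w Rat.infinitePlace]
      rw [kummerRelaxed_of_mem W 2 _ hw]
      exact AddSubgroup.mem_top _
    · rw [kummerRelaxed_of_not_mem W 2 _ (hfin v)]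
      exact (hdict v).mp (h v)
  · intro h v
    have h' := h (Sum.inr v)
    rw [kummerRelaxed_of_not_mem W 2 _ (hfin v)] at h'
    exact (hdict v).mpr h'

/-! ## §22 DESC-§17-IDX BY NAME -/

/-- **DESC-§17-IDX `F1Sign2.SelmerIndexInRelaxedAtInfinityAtTwo` HOLDS**: for every elliptic `E/ℚ`, `Sel₂(W) ≤ Sel^{rel ∞}_2(W)` with index `1`
or `2` — Mazur–Rubin 2010 Lemma 3.2 at `T = {∞}` (the real place being OURS): `H¹_{strict ∞} ≤ Sel₂ ≤ H¹_{relaxed ∞}`,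
`[H¹_{relaxed ∞} : H¹_{strict ∞}] = #𝓛_∞ ∈ {1, 2}` (archimedean Kummer count, Poitou–Tate inputs discharged), and the middle index divides it.
[cite: MazurRubin2010, Lemma 3.2] [cite: MilneADT2006, Ch. I, Thm. 4.10 and Lemma 6.15] [cite: Kramer1981, Prop. 6] -/
theorem selmerIndexInRelaxedAtInfinityAtTwo_holds : SelmerIndexInRelaxedAtInfinityAtTwo := by
  intro W _
  refine ⟨selmerGroup_le_selmerGroupRelaxedAtInfinityAtTwo W, ?_⟩
  obtain ⟨w₀, hw₀⟩ : ∃ w₀ : InfinitePlace ℚ, w₀ = Rat.infinitePlace := ⟨_, rfl⟩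
  obtain ⟨S', hS'⟩ : ∃ S' : Finset (Place ℚ), S' = {(Sum.inl w₀ : Place ℚ)} := ⟨_, rfl⟩
  have hSel : W.selmerGroup ((2 : ℕ) : ℤ) = (W.kummerSelmerStructure ((2 : ℕ) : ℤ)).selmerGroup :=
    W.selmerGroup_eq_selmerGroup_kummerSelmerStructure ((2 : ℕ) : ℤ)
  have hRel : selmerGroupRelaxedAtInfinityAtTwo W = (kummerRelaxed W 2 S').selmerGroup := by
    rw [hS', hw₀]; exact selmerGroupRelaxedAtInfinityAtTwo_eq_kummerRelaxed W
  -- `H¹_{strict ∞} ≤ Sel₂(W)`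
  have hstr_le : (kummerStrict W 2 S').selmerGroup ≤ (W.kummerSelmerStructure ((2 : ℕ) : ℤ)).selmerGroup := by
    intro x hx
    refine (SelmerStructure.mem_selmerGroup_iff _ x).2 fun v ↦ ?_
    have hxv := (SelmerStructure.mem_selmerGroup_iff _ x).1 hx v
    by_cases hv : v ∈ S'
    · rw [kummerStrict_of_mem W 2 S' hv, AddSubgroup.mem_bot] at hxv
      rw [hxv]
      exact zero_mem _
    · rw [kummerStrict_of_not_mem W 2 S' hv] at hxv
      exact hxv
  -- the archimedean Kummer count `[H¹_{relaxed ∞} : H¹_{strict ∞}] = #𝓛_∞`, Poitou–Tate inputs discharged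
  have hidx : ((kummerStrict W 2 S').selmerGroup).relIndex (kummerRelaxed W 2 S').selmerGroup =
      Nat.card (W.kummerSelmerStructure ((2 : ℕ) : ℤ) (Sum.inl w₀)) := by
    rw [hS']
    exact relIndex_kummerStrict_kummerRelaxed_singleton_inl_eq_of_facts W 2 Nat.prime_two.isPrimePow
      (poitouTate_selmerStructure_duality_real_holds ℚ) (forall_localEulerPoincareCharacteristic_adicCompletion ℚ) w₀
  have hdvd : (W.selmerGroup ((2 : ℕ) : ℤ)).relIndex (selmerGroupRelaxedAtInfinityAtTwo W) ∣
      Nat.card (W.kummerSelmerStructure ((2 : ℕ) : ℤ) (Sum.inl w₀)) := by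
    rw [← hidx, hRel, hSel]
    exact AddSubgroup.relIndex_dvd_of_le_left _ hstr_le
  -- `#𝓛_∞ = 1` (`Δ < 0`) or `2` (`Δ > 0`)
  rcases lt_or_gt_of_ne W.isUnit_Δ.ne_zero with hneg | hpos
  · have h1 : Nat.card (W.kummerSelmerStructure ((2 : ℕ) : ℤ) (Sum.inl w₀)) = 1 := by
      rw [Nat.cast_ofNat]
      exact natCard_kummerSelmerStructure_inl_rat_eq_one_of_Δ_neg W hneg w₀
    rw [h1, Nat.dvd_one] at hdvd
    exact Or.inl hdvd
  · have h2 : Nat.card (W.kummerSelmerStructure ((2 : ℕ) : ℤ) (Sum.inl w₀)) = 2 := by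
      rw [Nat.cast_ofNat]
      exact natCard_kummerSelmerStructure_inl_rat_eq_two_of_Δ_pos W hpos w₀
    rw [h2] at hdvd
    exact (Nat.dvd_prime Nat.prime_two).mp hdvd

end Summit.BirchSwinnertonDyer.BirchSwinnertonDyer.Theorems.GenusKolyTransp

end
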